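import Mathlib.Analysis.Calculus.InverseFunctionTheorem.ContDiff
import Mathlib.Geometry.Manifold.LocalDiffeomorph
import Mathlib.Geometry.Manifold.ContMDiff.Atlas
import Mathlib.Geometry.Manifold.MFDeriv.Basic
import HarnessLib

/-!
# The inverse function theorem on manifolds over `ℝ` OR `ℂ` (`RCLike 𝕜`) — in particular for COMPLEX manifolds

Topic `Geometry/Manifold`.  The tree's ★ `Literature.Geometry.Manifold.isLocalDiffeomorphAt_of_mfderiv`
(`InverseFunctionTheorem.lean`, Lee Thm. 4.5) is stated over `ℝ`; its proof uses only Mathlib's Banach-space inverse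
function theorem `ContDiffAt.toOpenPartialHomeomorph` ∕ `ContDiffAt.to_localInverse`, which hold over any `RCLike` field.
This file repeats the statement and proof VERBATIM with `ℝ` replaced by an `RCLike` field `𝕜` (suffix `_rclike`), so that
it applies to HOLOMORPHIC maps between complex manifolds (`𝕜 = ℂ`, models `𝓘(ℂ, E)`): a holomorphic map with invertible
complex differential at a point is a holomorphic local diffeomorphism there — the holomorphic inverse function theorem
([FritzscheGrauert2002] Ch. I §7 Thm. 7.6; [Lee2013] Thm. 4.5 for the real statement).  Consumer (cell `hodgecm-mathlib`,
line L7 ∕ would-be L8 «REL-EXP», organ E8-5 of LA7-p01 (g0)'s CENSUS-P1): the étale clause `exists_localInverse` of the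
relative exponential chart ★ `IsRelExpChartOn` from the bijectivity of the differential of `ex`.

* `contDiffOn_symm_of_forall_hasFDerivAt_equiv_rclike` — local inverses of a `C^n` map are `C^n` on the whole target;
* **`isLocalDiffeomorphAt_of_mfderiv_rclike`** — inverse function theorem for `C^n` manifolds over `𝕜`, `RCLike 𝕜`.

Everything here is proved; no definitions; no named facts.

## References
* [LeeSmoothManifolds2013] J. M. Lee, *Introduction to Smooth Manifolds*, 2nd ed., GTM 218 (2013), Thm. 4.5.
* [FritzscheGrauert2002] K. Fritzsche, H. Grauert, *From Holomorphic Functions to Complex Manifolds*, GTM 213 (2002), Ch. I §7 Thm. 7.6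
  (holomorphic inverse function theorem).
-/

noncomputable section

open Set Filter Function Manifold
open scoped Manifold ContDiff Topology

namespace Literature.Geometry.Manifold

variable {𝕜 : Type*} [RCLike 𝕜] {E : Type*} [NormedAddCommGroup E] [NormedSpace 𝕜 E] [CompleteSpace E]
  {E' : Type*} [NormedAddCommGroup E'] [NormedSpace 𝕜 E']
  {H : Type*} [TopologicalSpace H] {I : ModelWithCorners 𝕜 E H} [I.Boundaryless]
  {H' : Type*} [TopologicalSpace H'] {J : ModelWithCorners 𝕜 E' H'} [J.Boundaryless]
  {M : Type*} [TopologicalSpace M] [ChartedSpace H M]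
  {N : Type*} [TopologicalSpace N] [ChartedSpace H' N]
  {n : WithTop ℕ∞}

/-- **Local inverses of a `C^n` map are `C^n` on the whole target** (the pointwise step of the
inverse function theorem, spread out): if `Ψ` is a local homeomorphism between Banach spaces which
agrees with a map `g` that is `C^n` (`n ≠ 0`) at every point of `Ψ.source` with an invertible
derivative there, then `Ψ.symm` is `C^n` on `Ψ.target` (at `y`, `Ψ.symm` agrees near `y` with
Mathlib's `ContDiffAt.localInverse` of `g` at `Ψ.symm y`, by uniqueness of local left inverses).
[cite: LeeSmoothManifolds2013, Thm. 4.5 (proof: uniqueness of local inverses)] -/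
theorem contDiffOn_symm_of_forall_hasFDerivAt_equiv_rclike (Ψ : OpenPartialHomeomorph E E') {g : E → E'}
    (hΨg : EqOn Ψ g Ψ.source) (hn : n ≠ 0)
    (hg : ∀ a ∈ Ψ.source, ContDiffAt 𝕜 n g a)
    (hg' : ∀ a ∈ Ψ.source, ∃ e : E ≃L[𝕜] E', HasFDerivAt g (e : E →L[𝕜] E') a) :
    ContDiffOn 𝕜 n Ψ.symm Ψ.target := by
  intro y hy
  set a := Ψ.symm y with ha
  have haS : a ∈ Ψ.source := Ψ.map_target hy
  have hya : g a = y := by rw [← hΨg haS, ha, Ψ.right_inv hy]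
  obtain ⟨e, he⟩ := hg' a haS
  have hga := hg a haS
  have hloc : ContDiffAt 𝕜 n (hga.localInverse he hn) (g a) := hga.to_localInverse he hn
  have hleft : ∀ᶠ z in 𝓝 a, Ψ.symm (g z) = z := by
    filter_upwards [Ψ.open_source.mem_nhds haS] with z hz
    rw [← hΨg hz, Ψ.left_inv hz]
  have heq : ∀ᶠ z in 𝓝 (g a), Ψ.symm z = hga.localInverse he hn z :=
    (hga.hasStrictFDerivAt' he hn).localInverse_unique hleft
  rw [← hya]
  exact (hloc.congr_of_eventuallyEq heq).contDiffWithinAt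

variable [IsManifold I n M] [IsManifold J n N]

/-- **Inverse function theorem for manifolds** (Lee, *Introduction to Smooth Manifolds* (2013),
Thm. 4.5). Let `f : M → N` be `C^n`, `n ≠ 0`, on an open set `s ∋ x` (manifolds over `𝕜` with
boundaryless models on complete normed spaces), and suppose the differential `mfderiv I J f x` is a
continuous linear equivalence `f' : E ≃L E'`. Then `f` is a `C^n` local diffeomorphism at `x`: there
is a `PartialDiffeomorph` with source an open neighbourhood of `x` agreeing with `f` there.
[cite: LeeSmoothManifolds2013, Thm. 4.5] -/
theorem isLocalDiffeomorphAt_of_mfderiv_rclike (hn : n ≠ 0) {f : M → N} {x : M} {s : Set M}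
    (hs : IsOpen s) (hx : x ∈ s) (hf : ContMDiffOn I J n f s)
    (f' : E ≃L[𝕜] E') (hf' : mfderiv I J f x = (f' : E →L[𝕜] E')) :
    IsLocalDiffeomorphAt I J n f x := by
  set φ := extChartAt I x with hφ
  set ψ := extChartAt J (f x) with hψ
  -- the open set of good chart points and the chart expression
  have hsf : IsOpen (s ∩ f ⁻¹' ψ.source) :=
    hf.continuousOn.isOpen_inter_preimage hs (isOpen_extChartAt_source (f x))
  set T : Set E := φ.target ∩ φ.symm ⁻¹' (s ∩ f ⁻¹' ψ.source) with hT
  have hTo : IsOpen T :=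
    (continuousOn_extChartAt_symm x).isOpen_inter_preimage (isOpen_extChartAt_target x) hsf
  set g : E → E' := ψ ∘ f ∘ φ.symm with hg
  have hxT : φ x ∈ T := by
    refine ⟨mem_extChartAt_target x, ?_⟩
    rw [mem_preimage, extChartAt_to_inv]
    exact ⟨hx, mem_extChartAt_source (f x)⟩
  have hgT : ContDiffOn 𝕜 n g T := (contMDiffOn_iff.1 hf).2 x (f x)
  -- points of `T` come from `s` and are mapped into the chart domain of `f x`
  have hTs : ∀ z ∈ T, φ.symm z ∈ s ∧ f (φ.symm z) ∈ ψ.source := fun z hz ↦ hz.2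
  -- the derivative of the chart expression at `φ x` is `f'`
  have hmd : MDifferentiableAt I J f x :=
    (hf.contMDiffAt (hs.mem_nhds hx)).mdifferentiableAt hn
  have hgx : HasFDerivAt g (f' : E →L[𝕜] E') (φ x) := by
    have hd : DifferentiableAt 𝕜 g (φ x) :=
      (hgT.differentiableOn hn _ hxT).differentiableAt (hTo.mem_nhds hxT)
    have h1 : mfderiv I J f x = fderivWithin 𝕜 (writtenInExtChartAt I J x f) (range I) (φ x) :=
      hmd.mfderiv
    rw [ModelWithCorners.Boundaryless.range_eq_univ, fderivWithin_univ] at h1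
    have h2 : fderiv 𝕜 g (φ x) = (f' : E →L[𝕜] E') := by rw [← hf', h1]; rfl
    rw [← h2]
    exact hd.hasFDerivAt
  -- shrink `T` to where the derivative of `g` is invertible
  set W : Set E := T ∩ (fderiv 𝕜 g) ⁻¹' range ((↑) : (E ≃L[𝕜] E') → E →L[𝕜] E') with hW
  have hWo : IsOpen W :=
    (hgT.continuousOn_fderiv_of_isOpen hTo (ENat.one_le_iff_ne_zero_withTop.2 hn)).isOpen_inter_preimage hTo
      ContinuousLinearEquiv.isOpen
  have hxW : φ x ∈ W := ⟨hxT, ⟨f', hgx.fderiv.symm⟩⟩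
  -- Mathlib's inverse function theorem at `φ x`, restricted to `W`
  have hgxn : ContDiffAt 𝕜 n g (φ x) := hgT.contDiffAt (hTo.mem_nhds hxT)
  set Ψ₀ := hgxn.toOpenPartialHomeomorph g hgx hn with hΨ₀
  set Ψ := Ψ₀.restrOpen W hWo with hΨ
  have hΨg : ∀ z, Ψ z = g z := fun z ↦ rfl
  have hΨsrc : Ψ.source = Ψ₀.source ∩ W := Ψ₀.restrOpen_source W hWo
  have hxΨ : φ x ∈ Ψ.source := by
    rw [hΨsrc]
    exact ⟨hgxn.mem_toOpenPartialHomeomorph_source hgx hn, hxW⟩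
  have hΨW : Ψ.source ⊆ W := by rw [hΨsrc]; exact inter_subset_right
  have hΨT : Ψ.source ⊆ T := fun z hz ↦ (hΨW hz).1
  -- the inverse is `C^n` on the target
  have hΨsymm : ContDiffOn 𝕜 n Ψ.symm Ψ.target := by
    refine contDiffOn_symm_of_forall_hasFDerivAt_equiv_rclike Ψ (fun z _ ↦ hΨg z) hn
      (fun a ha ↦ hgT.contDiffAt (hTo.mem_nhds (hΨT ha))) fun a ha ↦ ?_
    obtain ⟨e, he⟩ := (hΨW ha).2
    refine ⟨e, ?_⟩
    rw [he]
    exact ((hgT.differentiableOn hn _ (hΨT ha)).differentiableAt (hTo.mem_nhds (hΨT ha))).hasFDerivAt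
  -- assemble the partial diffeomorphism `φ⁻¹ ∘ Ψ ∘ φ` read back on the manifolds
  set P : PartialEquiv M N := φ.trans (Ψ.toPartialEquiv.trans ψ.symm) with hP
  have hPsrc : P.source = φ.source ∩ φ ⁻¹' (Ψ.source ∩ Ψ ⁻¹' ψ.target) := by
    rw [hP, PartialEquiv.trans_source, PartialEquiv.trans_source, PartialEquiv.symm_source]
    rfl
  have hPtgt : P.target = ψ.source ∩ ψ ⁻¹' (Ψ.target ∩ Ψ.symm ⁻¹' φ.target) := by
    ext y
    simp only [hP, PartialEquiv.trans_target, PartialEquiv.symm_target, PartialEquiv.symm_symm,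
      mem_inter_iff, mem_preimage, PartialEquiv.coe_trans_symm, comp_apply,
      OpenPartialHomeomorph.coe_toPartialEquiv_symm]
    tauto
  have hPo_src : IsOpen P.source := by
    rw [hPsrc]
    refine (continuousOn_extChartAt x).isOpen_inter_preimage (isOpen_extChartAt_source x) ?_
    exact Ψ.continuousOn.isOpen_inter_preimage Ψ.open_source (isOpen_extChartAt_target (f x))
  have hPo_tgt : IsOpen P.target := by
    rw [hPtgt]
    refine (continuousOn_extChartAt (f x)).isOpen_inter_preimage (isOpen_extChartAt_source (f x)) ?_
    exact Ψ.continuousOn_symm.isOpen_inter_preimage Ψ.open_target (isOpen_extChartAt_target x)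
  -- on its source `P` is `f`
  have hPf : EqOn f P P.source := by
    intro x' hx'
    rw [hPsrc] at hx'
    obtain ⟨hx'φ, hx'Ψ, -⟩ := hx'
    have h1 : φ.symm (φ x') = x' := φ.left_inv hx'φ
    have h2 : f x' ∈ ψ.source := by
      have h := (hTs _ (hΨT hx'Ψ)).2
      rwa [h1] at h
    show f x' = ψ.symm (Ψ (φ x'))
    rw [hΨg, hg]
    simp only [comp_apply]
    rw [h1, ψ.left_inv h2]
  have hPsrc_s : P.source ⊆ s := by
    intro x' hx'
    rw [hPsrc] at hx'
    have h := (hTs _ (hΨT hx'.2.1)).1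
    rwa [φ.left_inv hx'.1] at h
  -- smoothness of `P` and of its inverse
  have hP₁ : ContMDiffOn I J n P P.source :=
    (hf.mono hPsrc_s).congr fun x' hx' ↦ (hPf hx').symm
  have hP₂ : ContMDiffOn J I n P.symm P.target := by
    have hc₁ : ContMDiffOn J 𝓘(𝕜, E') n ψ ψ.source := by
      rw [hψ, extChartAt_source]
      exact contMDiffOn_extChartAt
    have hc₂ : ContMDiffOn 𝓘(𝕜, E') 𝓘(𝕜, E) n Ψ.symm Ψ.target := contMDiffOn_iff_contDiffOn.2 hΨsymm
    have hc₃ : ContMDiffOn 𝓘(𝕜, E) I n φ.symm φ.target := contMDiffOn_extChartAt_symm x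
    have hcomp : ContMDiffOn J I n (φ.symm ∘ Ψ.symm ∘ ψ) P.target := by
      rw [hPtgt]
      have h12 : ContMDiffOn 𝓘(𝕜, E') I n (φ.symm ∘ Ψ.symm) (Ψ.target ∩ Ψ.symm ⁻¹' φ.target) :=
        hc₃.comp (hc₂.mono inter_subset_left) fun z hz ↦ hz.2
      exact h12.comp (hc₁.mono inter_subset_left) fun y hy ↦ hy.2
    refine hcomp.congr fun y _ ↦ ?_
    rfl
  let Φ : PartialDiffeomorph I J M N n :=
    { toPartialEquiv := P
      open_source := hPo_src
      open_target := hPo_tgt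
      contMDiffOn_toFun := hP₁
      contMDiffOn_invFun := hP₂ }
  refine ⟨Φ, ?_, hPf⟩
  show x ∈ P.source
  rw [hPsrc]
  refine ⟨mem_extChartAt_source x, hxΨ, ?_⟩
  show Ψ (φ x) ∈ ψ.target
  rw [hΨg, hg]
  simp only [comp_apply]
  rw [extChartAt_to_inv]
  exact mem_extChartAt_target (f x)

end Literature.Geometry.Manifold
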